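import Summits.CriticalPhenomena.PercolationContinuityZ3.Theorems.Transplant.PlanarSkeletonFrmRayHolds
import Summits.CriticalPhenomena.PercolationContinuityZ3.Theorems.Transplant.PlanarSkeletonFrmCylHolds
import Summits.CriticalPhenomena.PercolationContinuityZ3.Theorems.Transplant.PlanarSkeletonConcBoxProd
import HarnessLib

/-!
# PRODUCTS `X □ Y` for the `{±1}` and `(ℤ/2)²` interfaces: `X` quasi-transitive times ANY `PlanarSkeletonSign` carrier `Y` has `θ_v(p_c) = 0`
# UNCONDITIONALLY; `X` vertex-transitive times any ONE-TYPE `PlanarSkeletonNeg` carrier likewise (gen 15)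

builds on p205010 (kernel theorem, internal audit signed; external expert review pending): the unconditional theorems run through the CLOSED nodes
`samePDropOfSkeletonSign_holds` (multi-type D″) and `samePDropOfSkeletonNeg₁_holds` (one-type `{±1}`) and through gen 15's Φ2 theorem
`PlanarSkeletonFrm.cylSubcritical_criticalProb_ray`; the multi-type `{±1}` product row is modulo the OPEN node `SamePDropOfSkeletonNeg` (hypothesis;
nothing is claimed about it).  Lane `prim-bschramm`, seat `prim-bschramm-p4` gen 15 (PART C3 of `P4-GENERAL.md`, §37.6).  Helper file
(`--supports stmt-CriticalPhenomena-4575 --as helper`).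

p4 gen 3 built the product skeleton for the `D₄` interface (`PlanarSkeleton.boxProdLeft`, `PlanarSkeletonConc.boxProdLeft`) and gen 11/12 for CAYLEY
factors (`prodSkeleton`, `prodSkeletonNeg`); the cylinders `X × C_ℓ^Y` of a product had to be shown subcritical case by case.  With Φ2 a theorem of the
bare interface this file does the general case:
* `PlanarSkeletonNeg.boxProdLeft`, `PlanarSkeletonSign.boxProdLeft` — `X` connected, locally finite, with orbit representatives `V₀` and a degree bound;
  `Y` ANY carrier: `φ = Φ.φ ∘ Prod.snd`, base vertices `V₀ × Φ.types`, frames `γ⁻¹ × α`, inversion / flip `id × α`, steps in the `Y`-slices, cylinders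
  `X × C_ℓ` (connected by `induce_univ_prod_connected`);
* **`bsConj4_boxProdSign_skeleton_only`**: `θ_{X □ Y}(v, p_c) = 0` at every vertex for EVERY connected, locally finite, quasi-transitive `X` and EVERY
  locally finite `Y` carrying a `PlanarSkeletonSign` — UNCONDITIONAL, no side condition (extends `bsConj4_boxProd_skeleton_only`, `Y` a `PlanarSkeletonConc`
  carrier, file `PlanarSkeletonFrmRayOfBase`);
* **`bsConj4_boxProdNeg_of_oneType`**: the same for vertex-TRANSITIVE `X` and `Y` carrying a ONE-TYPE `PlanarSkeletonNeg` (the product has one type;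
  node N1) — extends gen 12's `CayleyNeg₂.theta_boxProd_eq_zero_of_le` from Cayley factors to every one-type `{±1}` carrier;
* `bsConj4_boxProdNeg_of_negNode`: quasi-transitive `X`, any `PlanarSkeletonNeg` carrier `Y`, modulo the multi-type `{±1}` node;
  `PlanarSkeletonFrm.boxProdLeft` + `bsConj4_boxProdFrm_of_frmNode₁`: vertex-transitive `X`, one-type frames-only `Y`, modulo N2.
[cite: BenjaminiSchramm1996, Conj. 4; §2 (almost transitive graphs)] [cite: KozmaNitzan2024, §1 p. 2 (approach 1); §4 p. 16 (Lemma 8)]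
-/

noncomputable section

namespace Summit.CriticalPhenomena.PercolationContinuityZ3.Theorems.Transplant

open SimpleGraph Literature.Probability.LatticeModels Literature.Probability.Percolation
open Literature.Barriers.CriticalPhenomena (IsQuasiTransitive IsGraphTransitive countable_of_connected_of_locallyFinite)
open scoped Classical

variable {W U : Type}

/-! ## §1 The product skeletons -/

namespace PlanarSkeletonNeg

/-- **The `{±1}` skeleton of `X □ Y`** from a `{±1}` skeleton of `Y`, orbit representatives `V₀` of `Aut X` and a degree bound on `X`: `φ = Φ.φ ∘ Prod.snd`,
base vertices `V₀ × Φ.types`, frames `γ⁻¹ × α`, inversion `id × α`, steps in the `Y`-slices, cylinders `X × C_ℓ`.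
[cite: BenjaminiSchramm1996, §2 (almost transitive graphs)] [cite: KozmaNitzan2024, §4 p. 16 (Lemma 8)] -/
def boxProdLeft (X : SimpleGraph W) [X.LocallyFinite] (hc : X.Connected) {ΔX : ℕ} (hΔ : ∀ x, X.degree x ≤ ΔX)
    (V₀ : Finset W) (hV₀ : ∀ v : W, ∃ γ : X ≃g X, γ v ∈ V₀) {Y : SimpleGraph U} [Y.LocallyFinite] (Φ : PlanarSkeletonNeg Y) :
    PlanarSkeletonNeg (X □ Y) where
  φ := fun v => Φ.φ v.2
  lip := fun u v h i => by
    rcases SimpleGraph.boxProd_adj.1 h with ⟨_, h2⟩ | ⟨h2, _⟩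
    · rw [h2, sub_self, abs_zero]; exact zero_le_one
    · exact Φ.lip h2 i
  types := V₀ ×ˢ Φ.types
  frame := by
    intro v
    obtain ⟨γ, hγ⟩ := hV₀ v.1
    obtain ⟨t, ht, α, hαt, hα⟩ := Φ.frame v.2
    refine ⟨(γ v.1, t), Finset.mem_product.2 ⟨hγ, ht⟩, boxProdIso γ.symm α, ?_, fun w => ?_⟩
    · rw [boxProdIso_apply]; simp [hαt]
    · rw [boxProdIso_apply]; simp [hα]
  neg := by
    intro t ht
    obtain ⟨α, hαt, hα⟩ := Φ.neg t.2 (Finset.mem_product.1 ht).2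
    refine ⟨boxProdIso (SimpleGraph.Iso.refl (G := X)) α, ?_, fun w => ?_⟩
    · rw [boxProdIso_apply]; ext <;> simp [hαt]
    · rw [boxProdIso_apply]; simpa using hα w.2
  Δ := ΔX + Φ.Δ
  degree_le := fun v => by
    classical
    rw [degree_boxProd]
    exact add_le_add (hΔ v.1) (Φ.degree_le v.2)
  step := fun v i σ => by
    obtain ⟨u', hadj, hu'⟩ := Φ.step v.2 i σ
    exact ⟨(v.1, u'), (boxProd_adj (x := v) (y := (v.1, u'))).2 (Or.inr ⟨hadj, rfl⟩), hu'⟩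
  cyl_connected := fun t ht ℓ hℓ => by
    have ht2 : t.2 ∈ Φ.types := (Finset.mem_product.1 ht).2
    have e : {w : W × U | Φ.φ w.2 - Φ.φ t.2 ∈ box 2 ℓ} = (Set.univ : Set W) ×ˢ {u : U | Φ.φ u - Φ.φ t.2 ∈ box 2 ℓ} := by
      ext w; simp
    rw [e]
    exact induce_univ_prod_connected X Y hc (Φ.cyl_connected t.2 ht2 ℓ hℓ)

/-- Base vertices of the product skeleton. [folklore] -/
theorem mem_types_boxProdLeft (X : SimpleGraph W) [X.LocallyFinite] (hc : X.Connected) {ΔX : ℕ} (hΔ : ∀ x, X.degree x ≤ ΔX)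
    (V₀ : Finset W) (hV₀ : ∀ v : W, ∃ γ : X ≃g X, γ v ∈ V₀) {Y : SimpleGraph U} [Y.LocallyFinite] (Φ : PlanarSkeletonNeg Y) (t : W × U) :
    t ∈ (Φ.boxProdLeft X hc hΔ V₀ hV₀).types ↔ t.1 ∈ V₀ ∧ t.2 ∈ Φ.types :=
  Finset.mem_product

end PlanarSkeletonNeg

namespace PlanarSkeletonSign

/-- **The `(ℤ/2)²` skeleton of `X □ Y`** from a `(ℤ/2)²` skeleton of `Y`: the `{±1}` product skeleton plus the axis flips `id × α`.
[cite: BenjaminiSchramm1996, §2 (almost transitive graphs)] [cite: KozmaNitzan2024, §4 p. 16 (Lemma 8)] -/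
def boxProdLeft (X : SimpleGraph W) [X.LocallyFinite] (hc : X.Connected) {ΔX : ℕ} (hΔ : ∀ x, X.degree x ≤ ΔX)
    (V₀ : Finset W) (hV₀ : ∀ v : W, ∃ γ : X ≃g X, γ v ∈ V₀) {Y : SimpleGraph U} [Y.LocallyFinite] (Φ : PlanarSkeletonSign Y) :
    PlanarSkeletonSign (X □ Y) where
  toPlanarSkeletonNeg := Φ.toPlanarSkeletonNeg.boxProdLeft X hc hΔ V₀ hV₀
  flip := by
    intro t ht
    have ht2 : t.2 ∈ Φ.types := ((PlanarSkeletonNeg.mem_types_boxProdLeft X hc hΔ V₀ hV₀ Φ.toPlanarSkeletonNeg t).1 ht).2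
    obtain ⟨α, hαt, hα⟩ := Φ.flip t.2 ht2
    refine ⟨boxProdIso (SimpleGraph.Iso.refl (G := X)) α, ?_, fun w => ?_⟩
    · rw [boxProdIso_apply]; ext <;> simp [hαt]
    · rw [boxProdIso_apply]; simpa [PlanarSkeletonNeg.boxProdLeft] using hα w.2

end PlanarSkeletonSign

namespace PlanarSkeletonFrm

/-- **The frames-only skeleton of `X □ Y`** from a frames-only skeleton of `Y` (no point symmetry): `φ = Φ.φ ∘ Prod.snd`, base vertices
`V₀ × Φ.types`, frames `γ⁻¹ × α`, steps in the `Y`-slices, cylinders `X × C_ℓ`. [cite: BenjaminiSchramm1996, §2 (almost transitive graphs)] -/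
def boxProdLeft (X : SimpleGraph W) [X.LocallyFinite] (hc : X.Connected) {ΔX : ℕ} (hΔ : ∀ x, X.degree x ≤ ΔX)
    (V₀ : Finset W) (hV₀ : ∀ v : W, ∃ γ : X ≃g X, γ v ∈ V₀) {Y : SimpleGraph U} [Y.LocallyFinite] (Φ : PlanarSkeletonFrm Y) :
    PlanarSkeletonFrm (X □ Y) where
  φ := fun v => Φ.φ v.2
  lip := fun u v h i => by
    rcases SimpleGraph.boxProd_adj.1 h with ⟨_, h2⟩ | ⟨h2, _⟩
    · rw [h2, sub_self, abs_zero]; exact zero_le_one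
    · exact Φ.lip h2 i
  types := V₀ ×ˢ Φ.types
  frame := by
    intro v
    obtain ⟨γ, hγ⟩ := hV₀ v.1
    obtain ⟨t, ht, α, hαt, hα⟩ := Φ.frame v.2
    refine ⟨(γ v.1, t), Finset.mem_product.2 ⟨hγ, ht⟩, boxProdIso γ.symm α, ?_, fun w => ?_⟩
    · rw [boxProdIso_apply]; simp [hαt]
    · rw [boxProdIso_apply]; simp [hα]
  Δ := ΔX + Φ.Δ
  degree_le := fun v => by
    classical
    rw [degree_boxProd]
    exact add_le_add (hΔ v.1) (Φ.degree_le v.2)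
  step := fun v i σ => by
    obtain ⟨u', hadj, hu'⟩ := Φ.step v.2 i σ
    exact ⟨(v.1, u'), (boxProd_adj (x := v) (y := (v.1, u'))).2 (Or.inr ⟨hadj, rfl⟩), hu'⟩
  cyl_connected := fun t ht ℓ hℓ => by
    have ht2 : t.2 ∈ Φ.types := (Finset.mem_product.1 ht).2
    have e : {w : W × U | Φ.φ w.2 - Φ.φ t.2 ∈ box 2 ℓ} = (Set.univ : Set W) ×ˢ {u : U | Φ.φ u - Φ.φ t.2 ∈ box 2 ℓ} := by
      ext w; simp
    rw [e]
    exact induce_univ_prod_connected X Y hc (Φ.cyl_connected t.2 ht2 ℓ hℓ)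

end PlanarSkeletonFrm

/-! ## §2 Benjamini–Schramm's Conjecture 4 on the products -/

/-- **THEOREM (unconditional): `θ_{X □ Y}(v, p_c) = 0` at every vertex for EVERY connected, locally finite, quasi-transitive `X` (any growth) and
EVERY locally finite `Y` carrying a `PlanarSkeletonSign`** (any number of types) — no side condition.  builds on p205010 (kernel theorem, internal
audit signed; external expert review pending). [cite: BenjaminiSchramm1996, Conj. 4; §2 (almost transitive graphs)] [cite: Hutchcroft2016, Thm. 1] -/
theorem bsConj4_boxProdSign_skeleton_only [DecidableEq W] [DecidableEq U] (X : SimpleGraph W) [X.LocallyFinite] (hcX : X.Connected)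
    (hqX : IsQuasiTransitive X) {Y : SimpleGraph U} [Y.LocallyFinite] (Φ : PlanarSkeletonSign Y) (v : W × U) :
    theta (X □ Y) v (criticalProbIOf (X □ Y) v) = 0 := by
  obtain ⟨ΔX, hΔ⟩ := hqX.exists_degree_le
  obtain ⟨V₀, hV₀⟩ := hqX
  exact (Φ.boxProdLeft X hcX hΔ V₀ hV₀).criticalContinuity_skeleton_only v

/-- **THEOREM (unconditional): `θ_{X □ Y}(v, p_c) = 0` at every vertex for every connected, locally finite, VERTEX-TRANSITIVE `X` and every
locally finite `Y` carrying a ONE-TYPE `PlanarSkeletonNeg`** (the product skeleton has the one type `(x₀, t)`; node N1).  builds on p205010 (kernel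
theorem, internal audit signed; external expert review pending). [cite: BenjaminiSchramm1996, Conj. 4; §2] [cite: KozmaNitzan2024, §1 p. 2 (approach 1)] -/
theorem bsConj4_boxProdNeg_of_oneType [DecidableEq W] [DecidableEq U] (X : SimpleGraph W) [X.LocallyFinite] (hcX : X.Connected)
    (hT : IsGraphTransitive X) {Y : SimpleGraph U} [Y.LocallyFinite] (Φ : PlanarSkeletonNeg Y) {t : U} (h1 : Φ.types = {t}) (v : W × U) :
    theta (X □ Y) v (criticalProbIOf (X □ Y) v) = 0 := by
  have hV₀ : ∀ u : W, ∃ γ : X ≃g X, γ u ∈ ({v.1} : Finset W) := fun u => by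
    obtain ⟨γ, hγ⟩ := hT u v.1
    exact ⟨γ, by rw [hγ]; exact Finset.mem_singleton_self _⟩
  have hq : IsQuasiTransitive X := ⟨{v.1}, hV₀⟩
  obtain ⟨ΔX, hΔ⟩ := hq.exists_degree_le
  have htypes : (Φ.boxProdLeft X hcX hΔ {v.1} hV₀).types = {(v.1, t)} := by
    show ({v.1} : Finset W) ×ˢ Φ.types = _
    rw [h1, Finset.singleton_product_singleton]
  exact (Φ.boxProdLeft X hcX hΔ {v.1} hV₀).criticalContinuity_of_oneType htypes v

/-- **The multi-type `{±1}` product row, modulo the OPEN node `SamePDropOfSkeletonNeg`**: quasi-transitive `X`, any `PlanarSkeletonNeg` carrier `Y`.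
Nothing is claimed about the node. [cite: BenjaminiSchramm1996, Conj. 4; §2] -/
theorem bsConj4_boxProdNeg_of_negNode (hD : SamePDropOfSkeletonNeg) [DecidableEq W] [DecidableEq U] (X : SimpleGraph W) [X.LocallyFinite]
    (hcX : X.Connected) (hqX : IsQuasiTransitive X) {Y : SimpleGraph U} [Y.LocallyFinite] (Φ : PlanarSkeletonNeg Y) (v : W × U) :
    theta (X □ Y) v (criticalProbIOf (X □ Y) v) = 0 := by
  obtain ⟨ΔX, hΔ⟩ := hqX.exists_degree_le
  obtain ⟨V₀, hV₀⟩ := hqX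
  exact (Φ.boxProdLeft X hcX hΔ V₀ hV₀).criticalContinuity_of_negNode hD v

/-- **The frames-only product row, modulo the OPEN node N2 (`SamePDropOfSkeletonFrm₁`)**: vertex-transitive `X`, `Y` carrying a ONE-TYPE
`PlanarSkeletonFrm` (no point symmetry at all) ⟹ `θ_{X □ Y}(v, p_c) = 0` at every vertex, if N2 holds (Φ2, `p_c < 1`, uniqueness derived).  Extends
`ProdSkeletonFrm` (Cayley factors) to every one-type frames-only carrier; nothing is claimed about N2. [cite: BenjaminiSchramm1996, Conj. 4; §2] -/
theorem bsConj4_boxProdFrm_of_frmNode₁ (hD : SamePDropOfSkeletonFrm₁) [DecidableEq W] [DecidableEq U] (X : SimpleGraph W) [X.LocallyFinite]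
    (hcX : X.Connected) (hT : IsGraphTransitive X) {Y : SimpleGraph U} [Y.LocallyFinite] (Φ : PlanarSkeletonFrm Y) {t : U} (h1 : Φ.types = {t})
    (v : W × U) : theta (X □ Y) v (criticalProbIOf (X □ Y) v) = 0 := by
  have hV₀ : ∀ u : W, ∃ γ : X ≃g X, γ u ∈ ({v.1} : Finset W) := fun u => by
    obtain ⟨γ, hγ⟩ := hT u v.1
    exact ⟨γ, by rw [hγ]; exact Finset.mem_singleton_self _⟩
  have hq : IsQuasiTransitive X := ⟨{v.1}, hV₀⟩
  obtain ⟨ΔX, hΔ⟩ := hq.exists_degree_le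
  have htypes : (Φ.boxProdLeft X hcX hΔ {v.1} hV₀).types = {(v.1, t)} := by
    show ({v.1} : Finset W) ×ˢ Φ.types = _
    rw [h1, Finset.singleton_product_singleton]
  exact PlanarSkeletonFrm.criticalContinuity_of_frmNode₁ hD (X □ Y) (Φ.boxProdLeft X hcX hΔ {v.1} hV₀) htypes v

end Summit.CriticalPhenomena.PercolationContinuityZ3.Theorems.Transplant

end
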